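/-
Copyright (c) 2026. All rights reserved.
Released under Apache 2.0 license as described in the file LICENSE.
Authors: abc-iut cell, IUT REPAIR / RESCUE-H prover seat abc-iut-rp-d4 (gen 3).
-/
import Literature.IUT.LogVolume.UnitLogValuationProfile
import Literature.IUT.LogVolume.LogUnitsRootTwist
import Literature.AnabelianGeometry.AbsoluteAnabelian.LogShellsOfUnitLog
import HarnessLib

/-!
# The VALUATION PROFILE of `log_p(𝒪_K^×)` when `(p − 1) ∤ e`, II: the SHARP inner ball, the properly-met
# (SHAPE-OPEN) spheres, and the three-valued decision of `q ∈ qⁿ · ℐ_K` from `‖q‖` alone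

PROOF-ONLY sequel (no `def`, no named fact) of `UnitLogValuationProfile.lean` (abc-iut cell, D-0079 RESCUE-H
«local-height condition I06⋆», R-H lead's RE-ARM row «rp-d4 → REAL column of I06⋆ per stratum: κ^idx / SHAPE-OPEN
cells → deciding decls»).  Same setting: `K` a proper ultrametric normed `ℚ_p`-algebra, `e = absRamificationIdx p K`,
`ϖ` a norm uniformizer, `L = log_p(𝒪_K^×) = logUnits K`, `ℐ_K = (p*)⁻¹·L = Literature.AnabelianGeometry.AbsoluteAnabelian.logShell (PadicLogOnUnits.ofUnitLog p K)`
([AbsTopIII] Def. 5.4 (iii), `logShell_ofUnitLog`); `ν(s) = s·p^{a₀} − e·a₀` with `a₀` the turning point of `s`.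

* §5 **IN** (decided-POSITIVE spheres/balls): `{‖z‖ ≤ ‖ϖ‖ʳ} ⊆ L` for `e < r·(p−1)` (every `p`, `e`: successive
  approximation, abc-iut's `closedBall_subset_logUnits_of_mul_rpow_lt_one`) — the SHARP inner radius, since for
  `(p−1) ∤ e` and `r·(p−1) < e` the ball contains the MISS sphere of exponent `⌊e/(p−1)⌋` of part I
  (`not_closedBall_zpow_subset_logUnits_of_mul_lt`); a sphere lies in `L` iff the ball it bounds does
  (`closedBall_subset_logUnits_of_sphere_subset`).  Compare [IUTchIV] Prop. 1.2 (i): the exponent `e·a_e = ⌈e/(p−2)⌉`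
  there is `≥ ⌊e/(p−1)⌋ + 1`.
* §6 **MEET PROPERLY** (the honest SHAPE-OPEN spheres, `(p−1) ∤ e`): at `t = ν(s)` with `a₀ ≥ 1` (i.e. `s·(p−1) < e`)
  the sphere `{‖z‖ = ‖ϖ‖ᵗ}` contains the log-unit `log_p(1 − ϖˢ)` but is NOT contained in `L`
  (`sphere_meets_not_subset_logUnits`): for an element known only by its norm, membership is UNDECIDED there.
* §7 the log-shell dictionary for a norm-specified element: for `q ≠ 0` with `‖q‖ = ‖ϖ‖ᵐ`,
  `q ∈ qⁿ·ℐ_K ⟺ p*·q^{1−n} ∈ L` (`mem_pow_smul_logShell_iff`), and `‖p*·q^{1−n}‖ = ‖ϖ‖ᵗ`,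
  `t = e·ord_p(p*) − m·(n−1)` (`norm_pstar_mul_eq_zpow`).  Hence the deciding theorems:
  **POS** `mem_pow_smul_logShell_of_lt` (`e < t·(p−1)`; every `p`, `e`), **NEG** `not_mem_pow_smul_logShell_of_gap`
  (`t` in a gap `h_s(a₀) < t < ν(s+1)`, `(p−1) ∤ e`) and `not_mem_pow_smul_logShell_of_lt_min` (`t < ν(1)`, every `e`;
  the sharp form of Prop. 1.2 (i)'s outer radius), while at `t = ν(s)`, `a₀ ≥ 1`, §6 shows both behaviours among
  elements of that norm — the honest OPEN cells of a table filled from norms (e.g. abc-iut's CHOSEN realising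
  q-ideles, `Cor312ProvKChosenQIdeleNorm`).

Not treated: `(p − 1) ∣ e` (tie / `ζ_p` boundary: `UnitLogBoundaryRamification*`) and `p = 2`.  Classical `p`-adic
analysis; nothing here is disputed mathematics; no IUT statement is asserted (`logUnits`/`logShell` are the cell's
typings of [IUTchIV] Prop. 1.2's `log_p(R^×)` / [AbsTopIII] Def. 5.4 (iii)'s `ℐ_k`, [claim: Mochizuki2012, status: disputed]
for those locutions only); no side taken on [IUTchIII] Cor. 3.12 or on any author.
References: [cite: NeukirchANT1999, Ch. II Prop. (5.5), (5.7)] [cite: Koblitz1984, Ch. IV §1–2]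
[cite: MochizukiAbsTopIII2015, Def 5.4 (iii) p. 126].
-/

noncomputable section

open Metric Set
open scoped Pointwise

namespace Literature.IUT.LogVolume

namespace ValuationProfile

open Literature.NumberTheory.GaloisRepresentations.Ultrametric RamificationCriterion
  Literature.AnabelianGeometry.AbsoluteAnabelian

section Shell

variable (p : ℕ) [hp : Fact p.Prime]
variable {K : Type*} [NontriviallyNormedField K] [instK : NormedAlgebra ℚ_[p] K] [IsUltrametricDist K]
  [ProperSpace K]

/-! ### §5. IN: the sharp inner ball -/

/-- `‖ϖ‖ʳ · p^{1/(p−1)} < 1` iff ... — the sufficient half: `e < r·(p−1)` (as `‖ϖ‖ = p^{−1/e}`).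
[cite: NeukirchANT1999, Ch. II Prop. (5.5)] -/
theorem zpow_mul_rpow_lt_one_of_lt {ϖ : Kˣ} (hϖ : IsUniformizer ϖ) {r : ℤ}
    (hr : (absRamificationIdx p K : ℤ) < r * ((p : ℤ) - 1)) :
    ‖(ϖ : K)‖ ^ r * (p : ℝ) ^ (1 / ((p : ℝ) - 1)) < 1 := by
  have hp1 : (1 : ℝ) < p := by exact_mod_cast hp.out.one_lt
  have hp0 : (0 : ℝ) < p := by linarith
  have he0 : (0 : ℝ) < (absRamificationIdx p K : ℝ) := by exact_mod_cast absRamificationIdx_pos p K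
  rw [norm_unif_zpow_eq_rpow p hϖ r, ← Real.rpow_add hp0]
  refine Real.rpow_lt_one_of_one_lt_of_neg hp1 ?_
  have hr' : (absRamificationIdx p K : ℝ) < r * ((p : ℝ) - 1) := by exact_mod_cast hr
  have hp1' : (0 : ℝ) < (p : ℝ) - 1 := by linarith
  rw [div_add_div _ _ he0.ne' hp1'.ne', div_neg_iff]
  right
  refine ⟨by nlinarith, by positivity⟩

/-- **SHARP INNER BALL** (every `p`, every `e`): `e < r·(p−1)` ⟹ `{‖z‖ ≤ ‖ϖ‖ʳ} ⊆ log_p(𝒪_K^×)` — every such `z` is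
`L(y)` for a principal unit with `‖1 − y‖ ≤ ‖ϖ‖ʳ` (`exists_logSeries_eq`, successive approximation), packaged by
abc-iut's `closedBall_subset_logUnits_of_mul_rpow_lt_one`.  For `(p−1) ∤ e` the least such `r` is `⌊e/(p−1)⌋ + 1`;
[IUTchIV] Prop. 1.2 (i) uses the smaller ball of exponent `e·a_e = ⌈e/(p−2)⌉`. [cite: NeukirchANT1999, Ch. II Prop. (5.5)] -/
theorem closedBall_zpow_subset_logUnits_of_lt {ϖ : Kˣ} (hϖ : IsUniformizer ϖ) {r : ℤ}
    (hr : (absRamificationIdx p K : ℤ) < r * ((p : ℤ) - 1)) :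
    closedBall (0 : K) (‖(ϖ : K)‖ ^ r) ⊆ logUnits K :=
  closedBall_subset_logUnits_of_mul_rpow_lt_one p (zpow_mul_rpow_lt_one_of_lt p hϖ hr)

include instK in
/-- **A sphere lies in `log_p(𝒪_K^×)` iff the closed ball it bounds does** (the non-trivial half): if
`{‖z‖ = ‖ϖ‖ᵗ} ⊆ L` then `{‖z‖ ≤ ‖ϖ‖ᵗ} ⊆ L` — for `‖y‖ < ‖ϖ‖ᵗ`, `y = (y − ϖᵗ) + ϖᵗ` with both summands on the
sphere (isosceles principle) and `L` an additive subgroup. [cite: NeukirchANT1999, Ch. II Prop. (5.5)] -/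
theorem closedBall_subset_logUnits_of_sphere_subset {ϖ : Kˣ} {t : ℤ}
    (h : {z : K | ‖z‖ = ‖(ϖ : K)‖ ^ t} ⊆ logUnits K) :
    closedBall (0 : K) (‖(ϖ : K)‖ ^ t) ⊆ logUnits K := by
  intro y hy
  rw [mem_closedBall, dist_zero_right] at hy
  have hx : ‖((ϖ : K) ^ t)‖ = ‖(ϖ : K)‖ ^ t := norm_zpow _ _
  rcases hy.lt_or_eq with hlt | heq
  · have hxL : (ϖ : K) ^ t ∈ logUnits K := h hx
    have hdiff : ‖y + -((ϖ : K) ^ t)‖ = ‖(ϖ : K)‖ ^ t := by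
      have hne : ‖y‖ ≠ ‖-((ϖ : K) ^ t)‖ := by rw [norm_neg, hx]; exact hlt.ne
      rw [IsUltrametricDist.norm_add_eq_max_of_norm_ne_norm hne, norm_neg, hx, max_eq_right hlt.le]
    have hyx : y + -((ϖ : K) ^ t) ∈ logUnits K := h hdiff
    have hsum : (y + -((ϖ : K) ^ t)) + (ϖ : K) ^ t ∈ (logUnitsAddSubgroup p K : Set K) :=
      (logUnitsAddSubgroup p K).add_mem hyx hxL
    simpa using hsum
  · exact h heq

/-- **SHARPNESS of the inner radius** (`(p − 1) ∤ e`): if `r·(p−1) < e` then `{‖z‖ ≤ ‖ϖ‖ʳ} ⊄ log_p(𝒪_K^×)` — the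
ball contains the MISS sphere of exponent `⌊e/(p−1)⌋` (`norm_ne_zpow_floor_of_mem_logUnits`).  So
`{‖z‖ ≤ ‖ϖ‖ʳ} ⊆ log_p(𝒪_K^×) ⟺ e < r·(p−1)`. [cite: NeukirchANT1999, Ch. II Prop. (5.5)] -/
theorem not_closedBall_zpow_subset_logUnits_of_mul_lt (hnd : ¬ (p - 1) ∣ absRamificationIdx p K) {ϖ : Kˣ}
    (hϖ : IsUniformizer ϖ) {r : ℤ} (hr : r * ((p : ℤ) - 1) < absRamificationIdx p K) :
    ¬ closedBall (0 : K) (‖(ϖ : K)‖ ^ r) ⊆ logUnits K := by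
  intro hsub
  have hρ0 : 0 < ‖(ϖ : K)‖ := norm_units_pos ϖ
  set e : ℕ := absRamificationIdx p K with he_def
  have hp1 : 0 < p - 1 := by have := hp.out.two_le; omega
  -- `r₁ := ⌊e/(p−1)⌋`, with `r₁·(p−1) < e < (r₁+1)·(p−1)` since `(p−1) ∤ e`
  set r₁ : ℕ := e / (p - 1) with hr₁
  have hcast : ((p - 1 : ℕ) : ℤ) = (p : ℤ) - 1 := by rw [Nat.cast_sub hp.out.one_le, Nat.cast_one]
  have hmod := Nat.div_add_mod e (p - 1)
  have hmodlt := Nat.mod_lt e hp1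
  have hmod0 : e % (p - 1) ≠ 0 := fun h0 ↦ hnd (Nat.dvd_of_mod_eq_zero h0)
  have hlow : (r₁ : ℤ) * ((p : ℤ) - 1) < e := by
    rw [← hcast]
    have : r₁ * (p - 1) < e := by
      have h1 : (p - 1) * r₁ + e % (p - 1) = e := hmod
      have h2 : 0 < e % (p - 1) := Nat.pos_of_ne_zero hmod0
      rw [mul_comm]; omega
    exact_mod_cast this
  have hup : (e : ℤ) < ((r₁ : ℤ) + 1) * ((p : ℤ) - 1) := by
    rw [← hcast]
    have : e < (r₁ + 1) * (p - 1) := by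
      have h1 : (p - 1) * r₁ + e % (p - 1) = e := hmod
      rw [add_mul, one_mul, mul_comm]; omega
    exact_mod_cast this
  -- `r ≤ r₁`, so the sphere of exponent `r₁` lies in the ball of exponent `r`
  have hrle : r ≤ (r₁ : ℤ) := by
    by_contra hlt
    have hlt : (r₁ : ℤ) + 1 ≤ r := by omega
    have hp1' : (0 : ℤ) < (p : ℤ) - 1 := by have := hp.out.two_le; omega
    have : ((r₁ : ℤ) + 1) * ((p : ℤ) - 1) ≤ r * ((p : ℤ) - 1) := mul_le_mul_of_nonneg_right hlt hp1'.le
    linarith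
  have hmem : (ϖ : K) ^ (r₁ : ℤ) ∈ closedBall (0 : K) (‖(ϖ : K)‖ ^ r) := by
    rw [mem_closedBall, dist_zero_right, norm_zpow]
    exact zpow_le_zpow_right_of_le_one₀ hρ0 hϖ.1.le hrle
  exact norm_ne_zpow_floor_of_mem_logUnits p hnd hϖ hlow hup (hsub hmem) (norm_zpow _ _)

/-! ### §6. MEET PROPERLY: the honest SHAPE-OPEN spheres -/

/-- **The SHAPE-OPEN spheres** (`(p − 1) ∤ e`): at `t = ν(s) = s·p^{a₀} − e·a₀` with `a₀ ≥ 1` (equivalently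
`s·(p−1) < e`) the sphere `{‖z‖ = ‖ϖ‖ᵗ}` MEETS `log_p(𝒪_K^×)` (it contains `log_p(1 − ϖˢ)`) but is NOT contained in it
(else the ball of exponent `t` would be, §5, while `t ≤ s − a₀ < s` and `s·(p−1) < e`).  For an element specified
only by its norm `‖ϖ‖ᵗ`, membership in `log_p(𝒪_K^×)` is therefore NOT decided by these data.
[cite: NeukirchANT1999, Ch. II Prop. (5.5)] -/
theorem sphere_meets_not_subset_logUnits (hnd : ¬ (p - 1) ∣ absRamificationIdx p K) {ϖ : Kˣ}
    (hϖ : IsUniformizer ϖ) {s : ℕ} (hs : 1 ≤ s) {a₀ : ℕ} (ha₀ : a₀ ≠ 0)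
    (hlo : ∀ a < a₀, (s : ℤ) * (p : ℤ) ^ a * ((p : ℤ) - 1) < absRamificationIdx p K)
    (hhi : (absRamificationIdx p K : ℤ) < (s : ℤ) * (p : ℤ) ^ a₀ * ((p : ℤ) - 1)) :
    (∃ z ∈ logUnits K, ‖z‖ = ‖(ϖ : K)‖ ^ ((s : ℤ) * (p : ℤ) ^ a₀ - (absRamificationIdx p K : ℤ) * (a₀ : ℤ))) ∧
    ¬ {z : K | ‖z‖ = ‖(ϖ : K)‖ ^ ((s : ℤ) * (p : ℤ) ^ a₀ - (absRamificationIdx p K : ℤ) * (a₀ : ℤ))}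
        ⊆ logUnits K := by
  refine ⟨exists_mem_logUnits_norm_eq_zpow p hϖ hs hlo hhi, fun hsub ↦ ?_⟩
  have hball := closedBall_subset_logUnits_of_sphere_subset p hsub
  refine not_closedBall_zpow_subset_logUnits_of_mul_lt p hnd hϖ ?_ hball
  -- `t ≤ s − a₀ ≤ s − 1` and `s·(p−1) < e` (turning inequality at `a = 0 < a₀`)
  have hle := turningValue_add_le p (a₀ := a₀) hlo
  have h0 := hlo 0 (Nat.pos_of_ne_zero ha₀)
  simp only [pow_zero, mul_one] at h0
  have ha1 : (1 : ℤ) ≤ (a₀ : ℤ) := by exact_mod_cast Nat.one_le_iff_ne_zero.mpr ha₀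
  have hp1' : (0 : ℤ) < (p : ℤ) - 1 := by have := hp.out.two_le; omega
  rcases le_or_gt 0 ((s : ℤ) * (p : ℤ) ^ a₀ - (absRamificationIdx p K : ℤ) * (a₀ : ℤ)) with ht0 | ht0
  · calc ((s : ℤ) * (p : ℤ) ^ a₀ - (absRamificationIdx p K : ℤ) * (a₀ : ℤ)) * ((p : ℤ) - 1)
        ≤ ((s : ℤ) - 1) * ((p : ℤ) - 1) := mul_le_mul_of_nonneg_right (by linarith) hp1'.le
      _ < absRamificationIdx p K := by nlinarith
  · calc ((s : ℤ) * (p : ℤ) ^ a₀ - (absRamificationIdx p K : ℤ) * (a₀ : ℤ)) * ((p : ℤ) - 1)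
        < 0 := mul_neg_of_neg_of_pos ht0 hp1'
      _ ≤ absRamificationIdx p K := by positivity

/-! ### §7. The log-shell dictionary: `q ∈ qⁿ · ℐ_K` from `‖q‖` -/

/-- **`q ∈ qⁿ · ℐ_K ⟺ p*·q^{1−n} ∈ log_p(𝒪_K^×)`** for `q ≠ 0` (`ℐ_K = (p*)⁻¹·log_p(𝒪_K^×)`, `logShell_ofUnitLog`).
[cite: MochizukiAbsTopIII2015, Def 5.4 (iii) p. 126] -/
theorem mem_pow_smul_logShell_iff {q : K} (hq : q ≠ 0) (n : ℕ) :
    q ∈ q ^ n • Literature.AnabelianGeometry.AbsoluteAnabelian.logShell (PadicLogOnUnits.ofUnitLog p K) ↔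
      ((p ^ (if p = 2 then 2 else 1) : ℕ) : K) * ((q ^ n)⁻¹ * q) ∈ logUnits K := by
  rw [logShell_ofUnitLog]
  have hqn : q ^ n ≠ 0 := pow_ne_zero n hq
  have hps : ((p ^ (if p = 2 then 2 else 1) : ℕ) : K) ≠ 0 := pstarNat_cast_ne_zero p K
  constructor
  · rintro ⟨i, ⟨w, hw, rfl⟩, hqi⟩
    simp only [smul_eq_mul] at hqi
    have key : ((p ^ (if p = 2 then 2 else 1) : ℕ) : K) *
        ((q ^ n)⁻¹ * (q ^ n * ((((p ^ (if p = 2 then 2 else 1) : ℕ) : K))⁻¹ * w))) = w := by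
      rw [← mul_assoc (q ^ n)⁻¹, inv_mul_cancel₀ hqn, one_mul, ← mul_assoc, mul_inv_cancel₀ hps, one_mul]
    rw [hqi] at key
    rw [key]
    exact hw
  · intro h
    refine ⟨(q ^ n)⁻¹ * q, ⟨_, h, ?_⟩, ?_⟩
    · simp only [smul_eq_mul]
      rw [← mul_assoc, inv_mul_cancel₀ hps, one_mul]
    · simp only [smul_eq_mul]
      rw [← mul_assoc, mul_inv_cancel₀ hqn, one_mul]

/-- **The norm of `p*·q^{1−n}`**: with `‖q‖ = ‖ϖ‖ᵐ`, `‖p*·q^{1−n}‖ = ‖ϖ‖^{e·ord_p(p*) − m·(n−1)}`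
(`‖p‖ = ‖ϖ‖^e`, `ord_p(p*) = 1` for odd `p`, `2` for `p = 2`). [cite: MochizukiAbsTopIII2015, Def 5.4 (iii) p. 126] -/
theorem norm_pstar_mul_eq_zpow {ϖ : Kˣ} (hϖ : IsUniformizer ϖ) {q : K} {m : ℤ} (hqm : ‖q‖ = ‖(ϖ : K)‖ ^ m)
    (n : ℕ) :
    ‖((p ^ (if p = 2 then 2 else 1) : ℕ) : K) * ((q ^ n)⁻¹ * q)‖ =
      ‖(ϖ : K)‖ ^ ((absRamificationIdx p K : ℤ) * ((if p = 2 then 2 else 1 : ℕ) : ℤ) - m * ((n : ℤ) - 1)) := by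
  have hρ0 : 0 < ‖(ϖ : K)‖ := norm_units_pos ϖ
  have hρ : ‖(ϖ : K)‖ ≠ 0 := hρ0.ne'
  have h1 : ‖((p ^ (if p = 2 then 2 else 1) : ℕ) : K)‖ =
      ‖(ϖ : K)‖ ^ ((absRamificationIdx p K : ℤ) * ((if p = 2 then 2 else 1 : ℕ) : ℤ)) := by
    rw [Nat.cast_pow, norm_pow, norm_prime_eq_norm_pow p K hϖ, ← pow_mul, ← zpow_natCast]
    push_cast
    rfl
  have h2 : ‖(q ^ n)⁻¹ * q‖ = ‖(ϖ : K)‖ ^ (m - m * (n : ℤ)) := by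
    rw [norm_mul, norm_inv, norm_pow, hqm, ← zpow_natCast, ← zpow_mul, ← zpow_neg, ← zpow_add₀ hρ]
    congr 1
    ring
  rw [norm_mul, h1, h2, ← zpow_add₀ hρ]
  congr 1
  ring

/-- **DECIDED-POSITIVE cell**: `‖q‖ = ‖ϖ‖ᵐ` and `e < (e·ord_p(p*) − m·(n−1))·(p−1)` ⟹ `q ∈ qⁿ·ℐ_K` (the element
`p*·q^{1−n}` lies in the sharp inner ball, §5).  For odd `p` and `n = j²`: `(j²−1)·m + ⌊e/(p−1)⌋ + 1 ≤ e` suffices.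
[cite: NeukirchANT1999, Ch. II Prop. (5.5)] [cite: MochizukiAbsTopIII2015, Def 5.4 (iii) p. 126] -/
theorem mem_pow_smul_logShell_of_lt {ϖ : Kˣ} (hϖ : IsUniformizer ϖ) {q : K} (hq : q ≠ 0) {m : ℤ}
    (hqm : ‖q‖ = ‖(ϖ : K)‖ ^ m) {n : ℕ}
    (h : (absRamificationIdx p K : ℤ) <
      ((absRamificationIdx p K : ℤ) * ((if p = 2 then 2 else 1 : ℕ) : ℤ) - m * ((n : ℤ) - 1)) * ((p : ℤ) - 1)) :
    q ∈ q ^ n • Literature.AnabelianGeometry.AbsoluteAnabelian.logShell (PadicLogOnUnits.ofUnitLog p K) := by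
  rw [mem_pow_smul_logShell_iff p hq]
  apply closedBall_zpow_subset_logUnits_of_lt p hϖ h
  rw [mem_closedBall, dist_zero_right, norm_pstar_mul_eq_zpow p hϖ hqm n]

/-- **DECIDED-NEGATIVE cell, gap form** (`(p − 1) ∤ e`): with `t := e·ord_p(p*) − m·(n−1)` in a gap
`h_s(a₀) < t < ν(s+1)` of the profile (§4), `q ∉ qⁿ·ℐ_K`. [cite: NeukirchANT1999, Ch. II Prop. (5.5)] -/
theorem not_mem_pow_smul_logShell_of_gap (hnd : ¬ (p - 1) ∣ absRamificationIdx p K) {ϖ : Kˣ}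
    (hϖ : IsUniformizer ϖ) {q : K} (hq : q ≠ 0) {m : ℤ} (hqm : ‖q‖ = ‖(ϖ : K)‖ ^ m) {n : ℕ} {s : ℤ}
    (hs : 1 ≤ s) {a₀ a₁ : ℕ}
    (h1 : s * (p : ℤ) ^ a₀ - (absRamificationIdx p K : ℤ) * (a₀ : ℤ) <
      (absRamificationIdx p K : ℤ) * ((if p = 2 then 2 else 1 : ℕ) : ℤ) - m * ((n : ℤ) - 1))
    (hlo₁ : ∀ a < a₁, (s + 1) * (p : ℤ) ^ a * ((p : ℤ) - 1) < absRamificationIdx p K)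
    (hhi₁ : (absRamificationIdx p K : ℤ) ≤ (s + 1) * (p : ℤ) ^ a₁ * ((p : ℤ) - 1))
    (h2 : (absRamificationIdx p K : ℤ) * ((if p = 2 then 2 else 1 : ℕ) : ℤ) - m * ((n : ℤ) - 1) <
      (s + 1) * (p : ℤ) ^ a₁ - (absRamificationIdx p K : ℤ) * (a₁ : ℤ)) :
    q ∉ q ^ n • Literature.AnabelianGeometry.AbsoluteAnabelian.logShell (PadicLogOnUnits.ofUnitLog p K) := by
  rw [mem_pow_smul_logShell_iff p hq]
  intro hmem
  exact norm_ne_zpow_of_mem_logUnits_of_gap p hnd hϖ hs h1 hlo₁ hhi₁ h2 hmem (norm_pstar_mul_eq_zpow p hϖ hqm n)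

/-- **DECIDED-NEGATIVE cell, below the minimum** (every `e`): with `a₀` the turning point of `s = 1` and
`e·ord_p(p*) − m·(n−1) < p^{a₀} − e·a₀`, `q ∉ qⁿ·ℐ_K` (the sharp form of [IUTchIV] Prop. 1.2 (i)'s upper radius
`b_e`). [cite: NeukirchANT1999, Ch. II Prop. (5.5)] -/
theorem not_mem_pow_smul_logShell_of_lt_min {ϖ : Kˣ} (hϖ : IsUniformizer ϖ) {q : K} (hq : q ≠ 0) {m : ℤ}
    (hqm : ‖q‖ = ‖(ϖ : K)‖ ^ m) {n : ℕ} {a₀ : ℕ}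
    (hlo : ∀ a < a₀, (1 : ℤ) * (p : ℤ) ^ a * ((p : ℤ) - 1) < absRamificationIdx p K)
    (hhi : (absRamificationIdx p K : ℤ) ≤ 1 * (p : ℤ) ^ a₀ * ((p : ℤ) - 1))
    (h : (absRamificationIdx p K : ℤ) * ((if p = 2 then 2 else 1 : ℕ) : ℤ) - m * ((n : ℤ) - 1) <
      1 * (p : ℤ) ^ a₀ - (absRamificationIdx p K : ℤ) * (a₀ : ℤ)) :
    q ∉ q ^ n • Literature.AnabelianGeometry.AbsoluteAnabelian.logShell (PadicLogOnUnits.ofUnitLog p K) := by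
  rw [mem_pow_smul_logShell_iff p hq]
  intro hmem
  exact norm_ne_zpow_of_mem_logUnits_of_lt_min p hϖ hlo hhi h hmem (norm_pstar_mul_eq_zpow p hϖ hqm n)

end Shell

end ValuationProfile

end Literature.IUT.LogVolume

end
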